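/-
Copyright (c) 2026 the pub-hodgecm-mathlib formalisation cell (harness21).  Prover seat hodgecm-mathlib-K2E3-p25 (g5), Track B «K2-LIT»,
hLiu418 = `stmt-HodgeConjecture-24832`; K1a desk WORDS #36∕#38 «(C-K-1c)», FILE 2 of 3: the growth of the ray derivative.
THEOREMS ONLY (no `def`, no instance, no notation, no named-fact hypothesis, no `sorry`); lane `--supports stmt-HodgeConjecture-24832 --as helper`.
-/
import Summits.HodgeConjecture.HodgeConjecture.Theorems.K2LiuArchTwistedRayFactorDerivs        -- ★ (C-K-1c) FILE 1: the factored ray derivative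
import Summits.HodgeConjecture.HodgeConjecture.Theorems.K2LiuArchTwistedScalarLettersGrowthPi   -- ★ p864912∕p864875: witness growth, envelopes, (m2), `envFactor_pi_mul_le`
import HarnessLib

/-!
# Crux `HLiu418`, (Φ-S1) road B, (C-K-1c) FILE 2: GROWTH OF THE RAY DERIVATIVE OF THE EXPLICIT SCALAR-TYPE LETTER
# `‖d/dτ|₀ Ac s (g·exp(τX))‖ ≤ Cg · RX · Sz^{Mg} · e^{−π·P·t}`, `Mg Cg r` from `(k, N, z)` only

Cell `hodgecm-mathlib`, crux item hLiu418 = `stmt-HodgeConjecture-24832` (helper lane, count-neutral).  ★ FILE 1 writes the derivative as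
`G₀·(Φ_N·Λ + Φ′)`; here `‖G₀‖ ≤ B₀·Sz^{8n₁+1+5n₂}·e^{−πPt}` is ★ p864875's factor-by-factor product (F1)–(F12) without the witness, `‖Λ‖ ≤ ΛC·Sz⁶·RX`
from ★ (C-K-1a)'s majorants (`|tr| ≤ 128R²RX`, `|P′| ≤ 256R²RX·P`, `‖u′‖ ≤ 1056(1+R)⁴RX·tP`; `R, 1+R, t, P, P⁻¹ ≤ Sz`), `‖Φ_N‖ ≤ CΦπ^K·Sz^K` and
`‖Φ′‖ ≤ 256(‖1−k∕2‖+‖z‖+2)·CΦ′π^{K′}·Sz^{K′+3}·RX` by ★ `norm_witness_le_uniform` at `β₀` and at the SHIFTED `β₀ + 1 = 2 − k∕2` (same depth `N`,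
`k∕2 < N`).  Shape = ★ p864912 `norm_continuedFormula_le_pi` with two more binders `X, RX` and the factor `RX`: datum-uniform in `(a, t, g, X)`.
* §1 **`norm_deriv_continuedFormula_ray_le`**.

HONEST LABEL: growth bookkeeping, closes no socket; HC_CM is proved only modulo the 7 printed citations (2 remaining named inputs: hLiu418 =
`stmt-HodgeConjecture-24832`, h413 = `stmt-HodgeConjecture-24833`) until rung 0 closes.  REL ≠ ★ ≠ BUILT.

## References
* [Knapp1986] A. W. Knapp, *Representation Theory of Semisimple Groups*, Princeton (1986), Ch. VIII §3.
* [Shimura1982] G. Shimura, *Confluent hypergeometric functions on tube domains*, Math. Ann. 260 (1982), §3 Thm. 3.1, §4 Thm. 4.2, (4.34.K).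
* [Shimura1997] G. Shimura, *Euler Products and Eisenstein Series*, CBMS 93 (1997), §6.3, §16.4, §18.4–18.5.
-/

set_option autoImplicit false
set_option linter.dupNamespace false

noncomputable section

open Complex Matrix NormedSpace Set MeasureTheory Metric
open scoped ComplexConjugate ComplexOrder

namespace Summit.HodgeConjecture.HodgeConjecture.Cruxes.HLiu418.K2LiuArchTwistedRayDerivBound

open Literature.NumberTheory.ModularForms.SiegelUpperHalfSpace (num denom moeb)
open Summit.HodgeConjecture.HodgeConjecture.Cruxes.HLiu418.K2LiuHermTwoGammaDefs
open Summit.HodgeConjecture.HodgeConjecture.Cruxes.HLiu418.K2LiuHermitianTubeCocycle (isUnit_det_denom posDef_im_moeb posDef_im_I_smul_one)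
open Summit.HodgeConjecture.HodgeConjecture.Cruxes.HLiu418.K2LiuLocalKernelArchPlaceFactor (differentiableOn_Gamma_two_mul)
open Summit.HodgeConjecture.HodgeConjecture.Cruxes.HLiu418.K2LiuArchSiegelHalfSpaceHeightBounds (norm_det_denom_I_le norm_det_denom_I_inv_le inv_norm_det_im_moeb_I_le)
open Summit.HodgeConjecture.HodgeConjecture.Cruxes.HLiu418.K2LiuHermTwoEtaRankOneWitnessGrowth (one_le_envFactor rpow_le_envFactor_pow)
open Summit.HodgeConjecture.HodgeConjecture.Cruxes.HLiu418.K2LiuKindWArchWhittakerGrowth (norm_cexp_trace_mul_of_isHermitian)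
open Summit.HodgeConjecture.HodgeConjecture.Cruxes.HLiu418.K2LiuArchTwistedScalarLettersGrowth (norm_witness_le_uniform le_envFactor envFactor_le_of_sq_bounds)
open Summit.HodgeConjecture.HodgeConjecture.Cruxes.HLiu418.K2LiuArchTwistedScalarLettersGrowthPi (envFactor_pi_mul_le)
open Summit.HodgeConjecture.HodgeConjecture.Cruxes.HLiu418.K2LiuArchTwistedRayAtomBounds (norm_trace_inv_denom_mul_le)
open Summit.HodgeConjecture.HodgeConjecture.Cruxes.HLiu418.K2LiuArchTwistedRayFactorDerivs (hasDerivAt_continuedFormula_ray_explicit)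

/-! ## §1 The growth of the ray derivative -/

set_option maxHeartbeats 1600000 in
/-- **GROWTH OF THE RAY DERIVATIVE OF THE EXPLICIT SCALAR-TYPE LETTER** (π-edition witness letters (b)(c)(d) by value; non-negative index
`T = a·diag(t,0)·aᴴ`, `‖det a‖ = 1`, `t > 0`, `k∕2 < N`): for every `z` with `0 < re z` there are `Mg Cg r` — from `(k, N, z)` ONLY — with
`‖deriv (τ ↦ Ac s (g·exp(τX))) 0‖ ≤ Cg·RX·Sz^Mg·exp(−π·P·t)` for every `t > 0`, witness `Φ`, datum `a`, `g ∈ U(J)` with entries `≤ R`,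
`X ∈ 𝔲(J)` with entries `≤ RX`, `dist s z < r` (`Sz = (1+P)(1+P⁻¹)(1+t)(1+t⁻¹)(1+R)`, `P = Re (aᴴ(2·Im(g·i1))a)₀₀`).
[Knapp1986, Ch. VIII §3] [Shimura1982, §4 Thm. 4.2, (4.34.K)] [Shimura1997, §16.4, §18.4–18.5] -/
theorem norm_deriv_continuedFormula_ray_le (k : ℤ) (N : ℕ) (hN : (k : ℝ) / 2 < N) (z : ℂ) (hz : 0 < z.re) :
    ∃ (Mg : ℕ) (Cg r : ℝ), 0 ≤ Cg ∧ 0 < r ∧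
      ∀ (t : ℝ), 0 < t → ∀ (Φ : ℂ → ℂ → ℝ → ℂ → ℂ),
        (∀ (α₀ β₀ : ℂ) (p : ℝ), 0 < p → ∀ s : ℂ, 1 < (β₀ + s).re → Φ α₀ β₀ p s = (Complex.Gamma (β₀ + s - 1))⁻¹ *
          ∫ r in Ioi (0 : ℝ), cexp (-((p * r : ℝ) : ℂ)) * ((((r + 2 * (Real.pi * t) : ℝ)) : ℂ) ^ (α₀ + s - 2) * ((r : ℝ) : ℂ) ^ (β₀ + s - 2))) →
        (∀ (α₀ β₀ : ℂ) (p : ℝ), 0 < p → ∀ s : ℂ, 1 - N < (β₀ + s).re →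
          Φ α₀ β₀ p s = (p : ℂ) * Φ α₀ (β₀ + 1) p s - (α₀ + s - 2) * Φ (α₀ - 1) (β₀ + 1) p s) →
        (∀ (α₀ β₀ : ℂ) (p : ℝ), 0 < p → ∀ s : ℂ, 1 - (N : ℝ) < (β₀ + s).re →
          HasDerivAt (fun p' : ℝ => Φ α₀ β₀ p' s) (-(β₀ + s - 1) * Φ α₀ (β₀ + 1) p s) p) →
        ∀ (a : Matrix (Fin 2) (Fin 2) ℂ), ‖a.det‖ = 1 →
        ∀ (g : Matrix (Fin 2 ⊕ Fin 2) (Fin 2 ⊕ Fin 2) ℂ), gᴴ * Matrix.J (Fin 2) ℂ * g = Matrix.J (Fin 2) ℂ → ∀ (R : ℝ), (∀ i j, ‖g i j‖ ≤ R) →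
        ∀ (X : Matrix (Fin 2 ⊕ Fin 2) (Fin 2 ⊕ Fin 2) ℂ), Xᴴ * Matrix.J (Fin 2) ℂ + Matrix.J (Fin 2) ℂ * X = 0 → ∀ (RX : ℝ), (∀ i j, ‖X i j‖ ≤ RX) →
        ∀ s : ℂ, dist s z < r →
          ‖deriv (fun τ : ℝ =>
        ((denom (g * NormedSpace.exp (τ • X)) (I • (1 : Matrix (Fin 2) (Fin 2) ℂ))).det ^ (-k) *
            (((‖(denom (g * NormedSpace.exp (τ • X)) (I • (1 : Matrix (Fin 2) (Fin 2) ℂ))).det‖ : ℝ)) : ℂ) ^ ((k : ℂ) - 2 * s - 2) *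
            cexp ((2 * Real.pi * I) * (((a * hermTwo (t, 0, 0) * aᴴ) * ((2 : ℂ)⁻¹ • (moeb (g * NormedSpace.exp (τ • X)) (I • (1 : Matrix (Fin 2) (Fin 2) ℂ)) + (moeb (g * NormedSpace.exp (τ • X)) (I • (1 : Matrix (Fin 2) (Fin 2) ℂ)))ᴴ))).trace))) *
          ((1 / 8 : ℂ) * (((((4 * Real.pi ^ 4 : ℝ)) : ℂ) * cexp ((Real.pi * I) * ((s + 1 - k / 2) - (s + 1 + k / 2))) * ((Real.pi : ℂ)⁻¹ * (Complex.Gamma (s + 1 + k / 2))⁻¹ * (Complex.Gamma (s + 1 + k / 2 - 1))⁻¹) * ((Real.pi : ℂ)⁻¹ * (Complex.Gamma (s + 1 - k / 2))⁻¹)) *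
            (((Real.pi : ℂ) / (((aᴴ * ((2 : ℂ) • ((2 * I)⁻¹ • (moeb (g * NormedSpace.exp (τ • X)) (I • (1 : Matrix (Fin 2) (Fin 2) ℂ)) - (moeb (g * NormedSpace.exp (τ • X)) (I • (1 : Matrix (Fin 2) (Fin 2) ℂ)))ᴴ))) * a) 0 0).re) * cexp (-(((((aᴴ * ((2 : ℂ) • ((2 * I)⁻¹ • (moeb (g * NormedSpace.exp (τ • X)) (I • (1 : Matrix (Fin 2) (Fin 2) ℂ)) - (moeb (g * NormedSpace.exp (τ • X)) (I • (1 : Matrix (Fin 2) (Fin 2) ℂ)))ᴴ))) * a) 0 0).re) * (Real.pi * t) : ℝ) : ℂ))) *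
              ((1 / (((((aᴴ * ((2 : ℂ) • ((2 * I)⁻¹ • (moeb (g * NormedSpace.exp (τ • X)) (I • (1 : Matrix (Fin 2) (Fin 2) ℂ)) - (moeb (g * NormedSpace.exp (τ • X)) (I • (1 : Matrix (Fin 2) (Fin 2) ℂ)))ᴴ))) * a) 1 1).re) - normSq ((aᴴ * ((2 : ℂ) • ((2 * I)⁻¹ • (moeb (g * NormedSpace.exp (τ • X)) (I • (1 : Matrix (Fin 2) (Fin 2) ℂ)) - (moeb (g * NormedSpace.exp (τ • X)) (I • (1 : Matrix (Fin 2) (Fin 2) ℂ)))ᴴ))) * a) 0 1) / (((aᴴ * ((2 : ℂ) • ((2 * I)⁻¹ • (moeb (g * NormedSpace.exp (τ • X)) (I • (1 : Matrix (Fin 2) (Fin 2) ℂ)) - (moeb (g * NormedSpace.exp (τ • X)) (I • (1 : Matrix (Fin 2) (Fin 2) ℂ)))ᴴ))) * a) 0 0).re) : ℝ) : ℂ)) ^ ((s + 1 + k / 2) + (s + 1 - k / 2) - 2) * Complex.Gamma (2 * s))) *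
            Φ (1 + k / 2) (1 - k / 2) (((aᴴ * ((2 : ℂ) • ((2 * I)⁻¹ • (moeb (g * NormedSpace.exp (τ • X)) (I • (1 : Matrix (Fin 2) (Fin 2) ℂ)) - (moeb (g * NormedSpace.exp (τ • X)) (I • (1 : Matrix (Fin 2) (Fin 2) ℂ)))ᴴ))) * a) 0 0).re) s))) 0‖ ≤
            Cg * RX * ((((1 + (((aᴴ * ((2 : ℂ) • ((2 * I)⁻¹ • (moeb g (I • (1 : Matrix (Fin 2) (Fin 2) ℂ)) - (moeb g (I • (1 : Matrix (Fin 2) (Fin 2) ℂ)))ᴴ))) * a) 0 0).re)) * (1 + ((((aᴴ * ((2 : ℂ) • ((2 * I)⁻¹ • (moeb g (I • (1 : Matrix (Fin 2) (Fin 2) ℂ)) - (moeb g (I • (1 : Matrix (Fin 2) (Fin 2) ℂ)))ᴴ))) * a) 0 0).re))⁻¹)) * ((1 + t) * (1 + t⁻¹))) * (1 + R)) ^ Mg * Real.exp (-(Real.pi * ((((aᴴ * ((2 : ℂ) • ((2 * I)⁻¹ • (moeb g (I • (1 : Matrix (Fin 2) (Fin 2) ℂ)) - (moeb g (I • (1 :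 Matrix (Fin 2) (Fin 2) ℂ)))ᴴ))) * a) 0 0).re) * t))) := by
  /- the constants: §0's packages for `Φ (1+k/2) (1−k/2)` and `Φ (1+k/2) (2−k/2)`, the `Γ⁻¹`'s on `closedBall z 1`, `Γ(2s)` on `closedBall z (re z/2)`, the caps -/
  have hzΦ : 1 - (N : ℝ) < ((1 - (k : ℂ) / 2) + z).re := by
    simp only [add_re, sub_re, one_re, div_ofNat_re, intCast_re]; linarith
  have hzΦ' : 1 - (N : ℝ) < ((1 - (k : ℂ) / 2 + 1) + z).re := by
    simp only [add_re, sub_re, one_re, div_ofNat_re, intCast_re]; linarith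
  obtain ⟨K, CΦ, rΦ, hCΦ, hrΦ, hΦbd⟩ := norm_witness_le_uniform N N le_rfl (1 + (k : ℂ) / 2) (1 - (k : ℂ) / 2) z hzΦ
  obtain ⟨K', CΦ', rΦ', hCΦ', hrΦ', hΦbd'⟩ := norm_witness_le_uniform N N le_rfl (1 + (k : ℂ) / 2) (1 - (k : ℂ) / 2 + 1) z hzΦ'
  have hΓi : ∀ f : ℂ → ℂ, Differentiable ℂ f → ∃ C : ℝ, 0 ≤ C ∧ ∀ s ∈ closedBall z 1, ‖(Complex.Gamma (f s))⁻¹‖ ≤ C := fun f hf => by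
    have hcont : ContinuousOn (fun s : ℂ => (Complex.Gamma (f s))⁻¹) (closedBall z 1) :=
      ((Complex.differentiable_one_div_Gamma.comp hf).continuous).continuousOn
    obtain ⟨C, hC⟩ := (isCompact_closedBall z 1).exists_bound_of_continuousOn hcont
    exact ⟨C, (norm_nonneg _).trans (hC z (mem_closedBall_self zero_le_one)), hC⟩
  obtain ⟨C₁, hC₁0, hC₁⟩ := hΓi (fun s => s + 1 + (k : ℂ) / 2) (((differentiable_id).add_const _).add_const _)
  obtain ⟨C₂, hC₂0, hC₂⟩ := hΓi (fun s => s + 1 + (k : ℂ) / 2 - 1) ((((differentiable_id).add_const _).add_const _).sub_const _)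
  obtain ⟨C₃, hC₃0, hC₃⟩ := hΓi (fun s => s + 1 - (k : ℂ) / 2) (((differentiable_id).add_const _).sub_const _)
  have hΓ2 : ∃ C₄ : ℝ, 0 ≤ C₄ ∧ ∀ s ∈ closedBall z (z.re / 2), ‖Complex.Gamma (2 * s)‖ ≤ C₄ := by
    have hsub : closedBall z (z.re / 2) ⊆ {s : ℂ | 0 < s.re} := fun s hs => by
      have h1 : ‖s - z‖ ≤ z.re / 2 := by rw [← dist_eq_norm]; exact mem_closedBall.1 hs
      have h2 := (abs_le.1 ((abs_re_le_norm (s - z)).trans h1)).1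
      simp only [mem_setOf_eq, sub_re] at h2 ⊢; linarith
    obtain ⟨C, hC⟩ := (isCompact_closedBall z (z.re / 2)).exists_bound_of_continuousOn (differentiableOn_Gamma_two_mul.continuousOn.mono hsub)
    exact ⟨C, (norm_nonneg _).trans (hC z (mem_closedBall_self (by positivity))), hC⟩
  obtain ⟨C₄, hC₄0, hC₄⟩ := hΓ2
  set n₁ : ℕ := ⌈|(k : ℝ)| + 2 * z.re + 4⌉₊
  set n₂ : ℕ := ⌈2 * z.re + 2⌉₊
  set B₀ : ℝ := (256 : ℝ) ^ n₁ * (256 : ℝ) ^ n₁ * (1 / 8) * (4 * Real.pi ^ 4) * (Real.pi⁻¹ * C₁ * C₂) * (Real.pi⁻¹ * C₃) * Real.pi * ((16 : ℝ) ^ n₂ * C₄) with hB₀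
  set ΛC : ℝ := 128 * |(k : ℝ)| + 128 * (|(k : ℝ)| + 2 * ‖z‖ + 4) + 2112 * Real.pi + 256 * (1 + Real.pi) + 1024 * (‖z‖ + 1) with hΛC
  have hB₀0 : 0 ≤ B₀ := by rw [hB₀]; positivity
  have hΛC0 : 0 ≤ ΛC := by rw [hΛC]; positivity
  refine ⟨(4 * n₁ + 4 * n₁ + 1 + 5 * n₂) + (K + K' + 9), B₀ * ((CΦ * Real.pi ^ K) * ΛC + 256 * (‖(1 : ℂ) - (k : ℂ) / 2‖ + ‖z‖ + 2) * (CΦ' * Real.pi ^ K')),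
    min (min 1 (z.re / 2)) (min rΦ rΦ'), by positivity, lt_min (lt_min one_pos (by positivity)) (lt_min hrΦ hrΦ'), ?_⟩
  intro t ht Φ hΦb hΦc hΦd a hdet g hg R hR X hX RX hRX s hs
  have hs1 : dist s z < 1 := lt_of_lt_of_le hs ((min_le_left _ _).trans (min_le_left _ _))
  have hs2 : dist s z < z.re / 2 := lt_of_lt_of_le hs ((min_le_left _ _).trans (min_le_right _ _))
  have hsΦ : dist s z < rΦ := lt_of_lt_of_le hs ((min_le_right _ _).trans (min_le_left _ _))
  have hsΦ' : dist s z < rΦ' := lt_of_lt_of_le hs ((min_le_right _ _).trans (min_le_right _ _))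
  have hsre : |(s - z).re| ≤ dist s z := by rw [dist_eq_norm]; exact abs_re_le_norm _
  have hsre1 := abs_le.1 (hsre.trans hs1.le)
  have hsre2 := abs_le.1 (hsre.trans hs2.le)
  have hres0 : 0 < s.re := by rw [sub_re] at hsre2; linarith [hsre2.1]
  have hres1 : |s.re| ≤ z.re + 1 := by rw [sub_re] at hsre1; rw [abs_le]; constructor <;> linarith [hsre1.1, hsre1.2]
  have hsn : ‖s‖ ≤ ‖z‖ + 1 := by
    have h1 : ‖s - z‖ < 1 := by rwa [← dist_eq_norm]
    calc ‖s‖ = ‖z + (s - z)‖ := by rw [add_sub_cancel]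
      _ ≤ ‖z‖ + ‖s - z‖ := norm_add_le _ _
      _ ≤ ‖z‖ + 1 := by linarith only [h1]
  /- the derivative, factored (★ FILE 1), replaces `deriv` -/
  obtain ⟨P', u', hP', hu', hD⟩ := hasDerivAt_continuedFormula_ray_explicit k hg hX hR hRX hdet ht hN Φ hΦd
  rw [(hD s hres0).deriv]
  clear hD
  have htr : ‖(((denom g (I • (1 : Matrix (Fin 2) (Fin 2) ℂ)))⁻¹ * denom (g * X) (I • (1 : Matrix (Fin 2) (Fin 2) ℂ))).trace)‖ ≤ 128 * R ^ 2 * RX := norm_trace_inv_denom_mul_le hg hR hRX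
  set trc : ℂ := (((denom g (I • (1 : Matrix (Fin 2) (Fin 2) ℂ)))⁻¹ * denom (g * X) (I • (1 : Matrix (Fin 2) (Fin 2) ℂ))).trace) with htrc
  set V : Matrix (Fin 2) (Fin 2) ℂ := ((2 * I)⁻¹ • (moeb g (I • (1 : Matrix (Fin 2) (Fin 2) ℂ)) - (moeb g (I • (1 : Matrix (Fin 2) (Fin 2) ℂ)))ᴴ)) with hV
  set gm : Matrix (Fin 2) (Fin 2) ℂ := aᴴ * ((2 : ℂ) • V) * a with hgm
  set P : ℝ := (gm 0 0).re with hP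
  set Q : ℝ := (gm 1 1).re with hQ
  set w : ℂ := gm 0 1 with hw
  set δ : ℂ := (denom g (I • (1 : Matrix (Fin 2) (Fin 2) ℂ))).det with hδ
  set E : ℝ := ((1 + P) * (1 + P⁻¹)) * ((1 + t) * (1 + t⁻¹)) with hE
  set Sz : ℝ := E * (1 + R) with hSz
  /- positivity of the weight coordinates (as in ★ p864004 §1) and the determinant identity `PQ − |w|² = 4·|det V|` -/
  have ha0 : a.det ≠ 0 := fun h0 => by rw [h0, norm_zero] at hdet; exact zero_ne_one hdet
  have haU : IsUnit a := (Matrix.isUnit_iff_isUnit_det a).mpr (Ne.isUnit ha0)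
  have hδ0 : δ ≠ 0 := (isUnit_det_denom hg posDef_im_I_smul_one).ne_zero
  have hδpos : 0 < ‖δ‖ := norm_pos_iff.mpr hδ0
  have hVpos : V.PosDef := posDef_im_moeb hg posDef_im_I_smul_one
  have h2V : ((2 : ℂ) • V).PosDef := by
    have h2 := hVpos.smul (by norm_num : (0 : ℝ) < 2)
    rwa [show ((2 : ℝ) • V) = ((2 : ℂ) • V) by rw [← Complex.coe_smul]; norm_num] at h2
  have hgm' : gm.PosDef := by
    have := Matrix.IsUnit.posDef_star_left_conjugate_iff (x := (2 : ℂ) • V) haU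
    rw [Matrix.star_eq_conjTranspose] at this
    exact this.mpr h2V
  have he : hermTwo (P, w, Q) = gm := hermTwo_eq_of_isHermitian hgm'.1
  have hgm'' : (hermTwo (P, w, Q)).PosDef := by rw [he]; exact hgm'
  obtain ⟨hp, hpq⟩ := (posDef_hermTwo_iff _).mp hgm''
  simp only at hp hpq
  have hdetg : gm.det = ((P * Q - normSq w : ℝ) : ℂ) := by rw [← he, det_hermTwo]
  have hnormg : ‖gm.det‖ = 4 * ‖V.det‖ := by
    rw [hgm, det_mul, det_mul, det_conjTranspose, det_smul, Fintype.card_fin]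
    simp only [norm_mul, norm_pow, Complex.star_def, Complex.norm_conj, hdet, Complex.norm_ofNat]
    norm_num
  have hPQ : P * Q - normSq w = 4 * ‖V.det‖ := by
    rw [← hnormg, hdetg, Complex.norm_real, Real.norm_of_nonneg (sub_nonneg.2 hpq.le)]
  have hVdet0 : 0 < ‖V.det‖ := by
    have h4 : 0 < 4 * ‖V.det‖ := by rw [← hPQ]; exact sub_pos.2 hpq
    exact pos_of_mul_pos_right h4 (by norm_num)
  have hR0 : 0 ≤ R := (norm_nonneg _).trans (hR (Sum.inl 0) (Sum.inl 0))
  have hEP1 : 1 ≤ (1 + P) * (1 + P⁻¹) := one_le_envFactor hp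
  have hEt1 : 1 ≤ (1 + t) * (1 + t⁻¹) := one_le_envFactor ht
  have hEP0 : 0 ≤ (1 + P) * (1 + P⁻¹) := zero_le_one.trans hEP1
  have hE1 : 1 ≤ E := one_le_mul_of_one_le_of_one_le hEP1 hEt1
  have hE0 : 0 < E := zero_lt_one.trans_le hE1
  have hSz1 : 1 + R ≤ Sz := le_mul_of_one_le_left (by positivity) hE1
  have hESz : E ≤ Sz := le_mul_of_one_le_right hE0.le (le_add_of_nonneg_right hR0)
  have hSzone : 1 ≤ Sz := (le_add_of_nonneg_right hR0).trans hSz1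
  have hSz0 : 0 < Sz := zero_lt_one.trans_le hSzone
  have hPE' : (1 + P) * (1 + P⁻¹) ≤ E := le_mul_of_one_le_right hEP0 hEt1
  have hPSz : P ≤ Sz := (((le_envFactor hp).1.trans hPE').trans hESz)
  have hPinvSz : P⁻¹ ≤ Sz := (((le_envFactor hp).2.trans hPE').trans hESz)
  have hRSz : R ≤ Sz := ((le_add_of_nonneg_left zero_le_one).trans hSz1)
  /- (m2) at `l = Fin 2`: `|δ| ≤ 8R²`, `|δ|⁻¹ ≤ 32R²`, `|det V|⁻¹ ≤ 64R⁴` -/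
  have hδle : ‖δ‖ ≤ 8 * R ^ 2 := by
    have h1 : ‖δ‖ ≤ (Fintype.card (Fin 2)).factorial * (2 * R) ^ Fintype.card (Fin 2) := norm_det_denom_I_le hR
    simp only [Fintype.card_fin, Nat.factorial_two, Nat.cast_ofNat] at h1
    linarith only [h1]
  have hδinv : ‖δ‖⁻¹ ≤ 32 * R ^ 2 := by
    have h1 : ‖δ⁻¹‖ ≤ (Fintype.card (Fin 2)).factorial * (2 * (Fintype.card (Fin 2)) * R) ^ Fintype.card (Fin 2) :=
      norm_det_denom_I_inv_le hg hR
    simp only [Fintype.card_fin, Nat.factorial_two, Nat.cast_ofNat, norm_inv] at h1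
    linarith only [h1]
  have hVinv : ‖V.det‖⁻¹ ≤ 64 * R ^ 4 := by
    have h1 : ‖V.det‖⁻¹ ≤ ((Fintype.card (Fin 2)).factorial * (2 * R) ^ Fintype.card (Fin 2)) ^ 2 := inv_norm_det_im_moeb_I_le hg hR
    simp only [Fintype.card_fin, Nat.factorial_two, Nat.cast_ofNat] at h1
    linarith only [h1]
  have hEnvδ : (1 + ‖δ‖) * (1 + ‖δ‖⁻¹) ≤ 256 * Sz ^ 4 :=
    (envFactor_le_of_sq_bounds hδpos hR0 hδle hδinv).trans (mul_le_mul_of_nonneg_left (pow_le_pow_left₀ (by positivity) hSz1 4) (by norm_num))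
  /- (F1) `‖δ^{-k}‖ ≤ 256^{n₁}·Sz^{4n₁}` -/
  have hF1 : ‖δ ^ (-k)‖ ≤ (256 : ℝ) ^ n₁ * Sz ^ (4 * n₁) := by
    rw [norm_zpow, ← Real.rpow_intCast]
    have hx : |(((-k : ℤ)) : ℝ)| ≤ |(k : ℝ)| + 2 * z.re + 4 := by rw [Int.cast_neg, abs_neg]; linarith only [hz]
    calc ‖δ‖ ^ (((-k : ℤ)) : ℝ) ≤ ((1 + ‖δ‖) * (1 + ‖δ‖⁻¹)) ^ n₁ := rpow_le_envFactor_pow hδpos hx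
      _ ≤ (256 * Sz ^ 4) ^ n₁ := pow_le_pow_left₀ (by positivity) hEnvδ n₁
      _ = (256 : ℝ) ^ n₁ * Sz ^ (4 * n₁) := by rw [mul_pow, ← pow_mul]
  /- (F2) `‖|δ|^{k−2s−2}‖ ≤ 256^{n₁}·Sz^{4n₁}` -/
  have hF2 : ‖(((‖δ‖ : ℝ)) : ℂ) ^ ((k : ℂ) - 2 * s - 2)‖ ≤ (256 : ℝ) ^ n₁ * Sz ^ (4 * n₁) := by
    rw [Complex.norm_cpow_eq_rpow_re_of_pos hδpos]
    have hx : |((k : ℂ) - 2 * s - 2).re| ≤ |(k : ℝ)| + 2 * z.re + 4 := by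
      have hre : ((k : ℂ) - 2 * s - 2).re = (k : ℝ) - 2 * s.re - 2 := by simp only [sub_re, intCast_re, mul_re, re_ofNat, im_ofNat]; ring
      rw [hre]
      have h3 := abs_le.1 hres1
      rw [abs_le]; constructor <;> linarith only [le_abs_self (k : ℝ), neg_abs_le (k : ℝ), h3.1, h3.2, hz]
    calc ‖δ‖ ^ ((k : ℂ) - 2 * s - 2).re ≤ ((1 + ‖δ‖) * (1 + ‖δ‖⁻¹)) ^ n₁ := rpow_le_envFactor_pow hδpos hx
      _ ≤ (256 * Sz ^ 4) ^ n₁ := pow_le_pow_left₀ (by positivity) hEnvδ n₁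
      _ = (256 : ℝ) ^ n₁ * Sz ^ (4 * n₁) := by rw [mul_pow, ← pow_mul]
  /- (F3) the character has modulus `1` -/
  have hF3 : ‖cexp ((2 * Real.pi * I) * ((a * hermTwo (t, 0, 0) * aᴴ) * ((2 : ℂ)⁻¹ • (moeb g (I • (1 : Matrix (Fin 2) (Fin 2) ℂ)) +
      (moeb g (I • (1 : Matrix (Fin 2) (Fin 2) ℂ)))ᴴ))).trace)‖ = 1 := by
    refine norm_cexp_trace_mul_of_isHermitian (Matrix.isHermitian_mul_mul_conjTranspose a (isHermitian_hermTwo _)).eq ?_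
    rw [conjTranspose_smul, conjTranspose_add, conjTranspose_conjTranspose, add_comm]
    congr 1
    simp
  /- (F4)–(F7) the numerical constants -/
  have hF4 : ‖(1 / 8 : ℂ)‖ = 1 / 8 := by simp
  have hF5 : ‖(((4 * Real.pi ^ 4 : ℝ)) : ℂ)‖ = 4 * Real.pi ^ 4 := by rw [Complex.norm_real, Real.norm_of_nonneg (by positivity)]
  have hF6 : ‖cexp ((Real.pi * I) * ((s + 1 - k / 2) - (s + 1 + k / 2)))‖ = 1 := by
    rw [show (Real.pi * I) * ((s + 1 - k / 2) - (s + 1 + k / 2)) = ((-(Real.pi * (k : ℝ)) : ℝ) : ℂ) * I by push_cast; ring,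
      Complex.norm_exp_ofReal_mul_I]
  have hF7 : ‖(Real.pi : ℂ)⁻¹‖ = Real.pi⁻¹ := by rw [norm_inv, Complex.norm_real, Real.norm_of_nonneg Real.pi_pos.le]
  have hsB1 : s ∈ closedBall z 1 := mem_closedBall.2 hs1.le
  have hΓ₁ : ‖(Complex.Gamma (s + 1 + k / 2))⁻¹‖ ≤ C₁ := hC₁ s hsB1
  have hΓ₂ : ‖(Complex.Gamma (s + 1 + k / 2 - 1))⁻¹‖ ≤ C₂ := hC₂ s hsB1
  have hΓ₃ : ‖(Complex.Gamma (s + 1 - k / 2))⁻¹‖ ≤ C₃ := hC₃ s hsB1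
  /- (F9) `‖π/P‖ ≤ π·Sz`; (F10) the Gaussian -/
  have hF9 : ‖(Real.pi : ℂ) / (P : ℂ)‖ ≤ Real.pi * Sz := by
    rw [norm_div, Complex.norm_real, Complex.norm_real, Real.norm_of_nonneg Real.pi_pos.le, Real.norm_of_nonneg hp.le, div_eq_mul_inv]
    exact mul_le_mul_of_nonneg_left hPinvSz Real.pi_pos.le
  have hF10 : ‖cexp (-(((P * (Real.pi * t) : ℝ)) : ℂ))‖ = Real.exp (-(Real.pi * (P * t))) := by
    rw [← ofReal_neg, Complex.norm_exp_ofReal]; ring_nf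
  /- (F12) `Γ(2s)`; (F13)(F13′) the witness at `β₀` and at `β₀ + 1` (parameter `π·t`; `E` must unfold here) -/
  have hΓ₄ : ‖Complex.Gamma (2 * s)‖ ≤ C₄ := hC₄ s (mem_closedBall.2 hs2.le)
  have hEπ : ((1 + P) * (1 + P⁻¹)) * ((1 + Real.pi * t) * (1 + (Real.pi * t)⁻¹)) ≤ Real.pi * Sz :=
    (mul_le_mul_of_nonneg_left (envFactor_pi_mul_le ht) hEP0).trans (by rw [mul_left_comm]; exact mul_le_mul_of_nonneg_left hESz Real.pi_pos.le)
  have hF13 : ‖Φ (1 + k / 2) (1 - k / 2) P s‖ ≤ (CΦ * Real.pi ^ K) * Sz ^ K := by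
    have h1 := hΦbd (Real.pi * t) (mul_pos Real.pi_pos ht) Φ hΦb hΦc P hp s hsΦ
    rw [mul_assoc, ← mul_pow]
    exact h1.trans (mul_le_mul_of_nonneg_left (pow_le_pow_left₀ (by positivity) hEπ K) hCΦ)
  have hF13' : ‖Φ (1 + k / 2) (1 - k / 2 + 1) P s‖ ≤ (CΦ' * Real.pi ^ K') * Sz ^ K' := by
    have h1 := hΦbd' (Real.pi * t) (mul_pos Real.pi_pos ht) Φ hΦb hΦc P hp s hsΦ'
    rw [mul_assoc, ← mul_pow]
    exact h1.trans (mul_le_mul_of_nonneg_left (pow_le_pow_left₀ (by positivity) hEπ K') hCΦ')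
  clear hΦbd hΦbd' hΦb hΦc hΦd
  have htSz : t ≤ Sz := ((le_envFactor ht).1.trans (le_mul_of_one_le_left (zero_le_one.trans hEt1) hEP1)).trans hESz
  have hn₂s : 2 * s.re ≤ n₂ := by
    have h1 : 2 * z.re + 2 ≤ n₂ := Nat.le_ceil _
    have h2 := hsre1.2
    rw [sub_re] at h2
    linarith only [h1, h2]
  /- seal the abbreviations: from here on `V g P Q w δ E Sz n₁ n₂` are opaque atoms (cheap `linarith`/`ring`/`gcongr`) -/
  clear_value Sz E δ w Q P gm V n₂ n₁
  /- (F11) `‖(1/(Q − |w|²/P))^{2s}‖ ≤ 16^{n₂}·Sz^{5n₂}` -/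
  have hx₀eq : 1 / (Q - normSq w / P) = P / (4 * ‖V.det‖) := by
    rw [← hPQ]
    have hQ' : Q - normSq w / P = (P * Q - normSq w) / P := by rw [sub_div, mul_div_cancel_left₀ Q hp.ne']
    rw [hQ', one_div_div]
  have hx₀pos : 0 < 1 / (Q - normSq w / P) := by rw [hx₀eq]; positivity
  have hx₀le : 1 / (Q - normSq w / P) ≤ 16 * Sz ^ 5 := by
    rw [hx₀eq]
    calc P / (4 * ‖V.det‖) = (P / 4) * ‖V.det‖⁻¹ := by rw [div_mul_eq_div_div, div_eq_mul_inv]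
      _ ≤ (Sz / 4) * (64 * R ^ 4) := mul_le_mul (by linarith) hVinv (inv_nonneg.2 (norm_nonneg _)) (by positivity)
      _ = 16 * (Sz * R ^ 4) := by ring
      _ ≤ 16 * (Sz * Sz ^ 4) := by gcongr
      _ = 16 * Sz ^ 5 := by ring
  have hF11 : ‖((1 : ℂ) / ((Q - normSq w / P : ℝ) : ℂ)) ^ ((s + 1 + k / 2) + (s + 1 - k / 2) - 2)‖ ≤ (16 : ℝ) ^ n₂ * Sz ^ (5 * n₂) := by
    have hcast : (1 : ℂ) / ((Q - normSq w / P : ℝ) : ℂ) = (((1 / (Q - normSq w / P) : ℝ)) : ℂ) := by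
      rw [Complex.ofReal_div, Complex.ofReal_one]
    rw [hcast, Complex.norm_cpow_eq_rpow_re_of_pos hx₀pos]
    have hre : ((s + 1 + k / 2) + (s + 1 - k / 2) - 2 : ℂ).re = 2 * s.re := by
      simp only [add_re, sub_re, one_re, div_ofNat_re, intCast_re, re_ofNat]; ring
    rw [hre]
    have h16 : (1 : ℝ) ≤ 16 * Sz ^ 5 := by linarith [one_le_pow₀ (M₀ := ℝ) (n := 5) hSzone]
    calc (1 / (Q - normSq w / P)) ^ (2 * s.re) ≤ (16 * Sz ^ 5) ^ (2 * s.re) := Real.rpow_le_rpow hx₀pos.le hx₀le (by linarith)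
      _ ≤ (16 * Sz ^ 5) ^ ((n₂ : ℕ) : ℝ) := Real.rpow_le_rpow_of_exponent_le h16 hn₂s
      _ = (16 : ℝ) ^ n₂ * Sz ^ (5 * n₂) := by rw [Real.rpow_natCast, mul_pow, ← pow_mul]
  /- ‖G₀‖: ★ p864875's product without its witness factor -/
  have hG0 : ‖((δ ^ (-k) * (((‖δ‖ : ℝ)) : ℂ) ^ ((k : ℂ) - 2 * s - 2) * cexp ((2 * Real.pi * I) * (((a * hermTwo (t, 0, 0) * aᴴ) * ((2 : ℂ)⁻¹ • (moeb g (I • (1 : Matrix (Fin 2) (Fin 2) ℂ)) + (moeb g (I • (1 : Matrix (Fin 2) (Fin 2) ℂ)))ᴴ))).trace))) * ((1 / 8 : ℂ) * (((((4 * Real.pi ^ 4 : ℝ)) : ℂ) * cexp ((Real.pi * I) * ((s + 1 - k / 2) - (s + 1 + k / 2))) * ((Real.pi : ℂ)⁻¹ * (Complex.Gamma (s + 1 + k / 2))⁻¹ * (Complex.Gamma (s + 1 + k / 2 - 1))⁻¹) * ((Real.pi : ℂ)⁻¹ * (Complex.Gamma (s + 1 - k / 2))⁻¹)) * (((Real.pi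 : ℂ) / ((P : ℝ) : ℂ) * cexp (-(((P * (Real.pi * t) : ℝ)) : ℂ))) * ((1 / (((Q - normSq w / P : ℝ)) : ℂ)) ^ ((s + 1 + k / 2) + (s + 1 - k / 2) - 2) * Complex.Gamma (2 * s))))))‖ ≤ B₀ * Sz ^ (4 * n₁ + 4 * n₁ + 1 + 5 * n₂) * Real.exp (-(Real.pi * (P * t))) := by
    simp only [norm_mul]
    rw [hF3, hF4, hF5, hF6, hF7, hF10]
    calc _ ≤ ((256 : ℝ) ^ n₁ * Sz ^ (4 * n₁)) * ((256 : ℝ) ^ n₁ * Sz ^ (4 * n₁)) * 1 *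
          (1 / 8 * (4 * Real.pi ^ 4 * 1 * (Real.pi⁻¹ * C₁ * C₂) * (Real.pi⁻¹ * C₃) *
            ((Real.pi * Sz) * Real.exp (-(Real.pi * (P * t))) * (((16 : ℝ) ^ n₂ * Sz ^ (5 * n₂)) * C₄)))) := by
          gcongr
      _ = B₀ * Sz ^ (4 * n₁ + 4 * n₁ + 1 + 5 * n₂) * Real.exp (-(Real.pi * (P * t))) := by rw [hB₀]; ring
  /- the velocity majorants: everything against `Sz` -/
  have hRX0 : 0 ≤ RX := (norm_nonneg _).trans (hRX (Sum.inl 0) (Sum.inl 0))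
  have hR2 : R ^ 2 ≤ Sz ^ 2 := pow_le_pow_left₀ hR0 hRSz 2
  have hSz26 : Sz ^ 2 ≤ Sz ^ 6 := pow_le_pow_right₀ hSzone (by norm_num)
  have hSz46 : Sz ^ 4 ≤ Sz ^ 6 := pow_le_pow_right₀ hSzone (by norm_num)
  have htrSz : ‖trc‖ ≤ 128 * Sz ^ 2 * RX := htr.trans (mul_le_mul_of_nonneg_right (mul_le_mul_of_nonneg_left hR2 (by norm_num)) hRX0)
  have hP'Sz : |P'| ≤ 256 * Sz ^ 2 * RX * P := hP'.trans (mul_le_mul_of_nonneg_right (mul_le_mul_of_nonneg_right (mul_le_mul_of_nonneg_left hR2 (by norm_num)) hRX0) hp.le)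
  have hl1 : ‖(-(k : ℂ) * trc)‖ ≤ 128 * |(k : ℝ)| * Sz ^ 6 * RX := by
    rw [norm_mul, norm_neg, Complex.norm_intCast]
    calc |(k : ℝ)| * ‖trc‖ ≤ |(k : ℝ)| * (128 * Sz ^ 2 * RX) := mul_le_mul_of_nonneg_left htrSz (abs_nonneg _)
      _ ≤ |(k : ℝ)| * (128 * Sz ^ 6 * RX) := by gcongr
      _ = 128 * |(k : ℝ)| * Sz ^ 6 * RX := by ring
  have hcs : ‖((k : ℂ) - 2 * s - 2)‖ ≤ |(k : ℝ)| + 2 * ‖z‖ + 4 := by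
    calc ‖(k : ℂ) - 2 * s - 2‖ ≤ ‖(k : ℂ) - 2 * s‖ + ‖(2 : ℂ)‖ := norm_sub_le _ _
      _ ≤ ‖(k : ℂ)‖ + ‖(2 : ℂ) * s‖ + ‖(2 : ℂ)‖ := by gcongr; exact norm_sub_le _ _
      _ = |(k : ℝ)| + 2 * ‖s‖ + 2 := by rw [Complex.norm_intCast, norm_mul, Complex.norm_ofNat]
      _ ≤ |(k : ℝ)| + 2 * ‖z‖ + 4 := by linarith only [hsn]
  have hl2 : ‖(((k : ℂ) - 2 * s - 2) * (((trc).re : ℝ) : ℂ))‖ ≤ 128 * (|(k : ℝ)| + 2 * ‖z‖ + 4) * Sz ^ 6 * RX := by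
    rw [norm_mul, Complex.norm_real, Real.norm_eq_abs]
    calc ‖(k : ℂ) - 2 * s - 2‖ * |trc.re| ≤ (|(k : ℝ)| + 2 * ‖z‖ + 4) * (128 * Sz ^ 2 * RX) :=
          mul_le_mul hcs ((abs_re_le_norm _).trans htrSz) (abs_nonneg _) (by positivity)
      _ ≤ (|(k : ℝ)| + 2 * ‖z‖ + 4) * (128 * Sz ^ 6 * RX) := by gcongr
      _ = 128 * (|(k : ℝ)| + 2 * ‖z‖ + 4) * Sz ^ 6 * RX := by ring
  have h2πI : ‖(2 * Real.pi * I : ℂ)‖ = 2 * Real.pi := by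
    rw [norm_mul, norm_mul, Complex.norm_I, mul_one, Complex.norm_ofNat, Complex.norm_real, Real.norm_of_nonneg Real.pi_pos.le]
  have hl3 : ‖((2 * Real.pi * I) * u')‖ ≤ 2112 * Real.pi * Sz ^ 6 * RX := by
    rw [norm_mul, h2πI]
    calc 2 * Real.pi * ‖u'‖ ≤ 2 * Real.pi * (1056 * (1 + R) ^ 4 * RX * (t * P)) := mul_le_mul_of_nonneg_left hu' (by positivity)
      _ ≤ 2 * Real.pi * (1056 * Sz ^ 4 * RX * (Sz * Sz)) := by gcongr
      _ = 2112 * Real.pi * Sz ^ 6 * RX := by ring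
  have hl5 : ‖(-(((P' : ℝ) : ℂ) / ((P : ℝ) : ℂ)) - (((P' * (Real.pi * t) : ℝ)) : ℂ))‖ ≤ 256 * (1 + Real.pi) * Sz ^ 6 * RX := by
    have h1 : ‖(((P' : ℝ) : ℂ) / ((P : ℝ) : ℂ))‖ ≤ 256 * Sz ^ 2 * RX := by
      rw [norm_div, Complex.norm_real, Complex.norm_real, Real.norm_eq_abs, Real.norm_of_nonneg hp.le, div_le_iff₀ hp]
      exact hP'Sz
    have h2 : ‖(((P' * (Real.pi * t) : ℝ)) : ℂ)‖ ≤ 256 * Sz ^ 2 * RX * Sz * (Real.pi * Sz) := by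
      rw [Complex.norm_real, Real.norm_eq_abs, abs_mul, abs_of_nonneg (by positivity : 0 ≤ Real.pi * t)]
      calc |P'| * (Real.pi * t) ≤ (256 * Sz ^ 2 * RX * P) * (Real.pi * Sz) := by gcongr
        _ ≤ (256 * Sz ^ 2 * RX * Sz) * (Real.pi * Sz) := by gcongr
    have h3 : 1 + Real.pi * Sz ^ 2 ≤ (1 + Real.pi) * Sz ^ 4 := by
      have a1 : (1 : ℝ) ≤ Sz ^ 4 := one_le_pow₀ hSzone
      have a2 : Sz ^ 2 ≤ Sz ^ 4 := pow_le_pow_right₀ hSzone (by norm_num)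
      calc 1 + Real.pi * Sz ^ 2 ≤ Sz ^ 4 + Real.pi * Sz ^ 4 := add_le_add a1 (mul_le_mul_of_nonneg_left a2 Real.pi_pos.le)
        _ = (1 + Real.pi) * Sz ^ 4 := by ring
    calc ‖(-(((P' : ℝ) : ℂ) / ((P : ℝ) : ℂ)) - (((P' * (Real.pi * t) : ℝ)) : ℂ))‖ ≤ ‖-(((P' : ℝ) : ℂ) / ((P : ℝ) : ℂ))‖ + ‖(((P' * (Real.pi * t) : ℝ)) : ℂ)‖ := norm_sub_le _ _
      _ ≤ 256 * Sz ^ 2 * RX + 256 * Sz ^ 2 * RX * Sz * (Real.pi * Sz) := by rw [norm_neg]; exact add_le_add h1 h2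
      _ = 256 * Sz ^ 2 * RX * (1 + Real.pi * Sz ^ 2) := by ring
      _ ≤ 256 * Sz ^ 2 * RX * ((1 + Real.pi) * Sz ^ 4) := by gcongr
      _ = 256 * (1 + Real.pi) * Sz ^ 6 * RX := by ring
  have he2 : (((s + 1 + k / 2) + (s + 1 - k / 2) - 2) : ℂ) = 2 * s := by ring
  have hl6 : ‖(((s + 1 + k / 2) + (s + 1 - k / 2) - 2) * (((P' / P + 2 * (trc).re : ℝ)) : ℂ))‖ ≤ 1024 * (‖z‖ + 1) * Sz ^ 6 * RX := by
    rw [he2, norm_mul, norm_mul, Complex.norm_ofNat, Complex.norm_real, Real.norm_eq_abs]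
    have h1a : |P' / P| ≤ 256 * Sz ^ 2 * RX := by rw [abs_div, abs_of_pos hp, div_le_iff₀ hp]; exact hP'Sz
    have h1b : |2 * trc.re| ≤ 2 * (128 * Sz ^ 2 * RX) := by
      rw [abs_mul, abs_two]; exact mul_le_mul_of_nonneg_left ((abs_re_le_norm _).trans htrSz) zero_le_two
    have h1 : |P' / P + 2 * trc.re| ≤ 512 * Sz ^ 2 * RX := ((abs_add_le _ _).trans (add_le_add h1a h1b)).trans (by ring_nf; rfl)
    calc 2 * ‖s‖ * |P' / P + 2 * trc.re| ≤ 2 * (‖z‖ + 1) * (512 * Sz ^ 2 * RX) := by gcongr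
      _ ≤ 2 * (‖z‖ + 1) * (512 * Sz ^ 6 * RX) := by gcongr
      _ = 1024 * (‖z‖ + 1) * Sz ^ 6 * RX := by ring
  have hΛ : ‖((-(k : ℂ) * trc) + (((k : ℂ) - 2 * s - 2) * (((trc).re : ℝ) : ℂ)) + ((2 * Real.pi * I) * u') + (-(((P' : ℝ) : ℂ) / ((P : ℝ) : ℂ)) - (((P' * (Real.pi * t) : ℝ)) : ℂ)) + (((s + 1 + k / 2) + (s + 1 - k / 2) - 2) * (((P' / P + 2 * (trc).re : ℝ)) : ℂ)))‖ ≤ ΛC * Sz ^ 6 * RX := by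
    refine ((norm_add_le _ _).trans (add_le_add ((norm_add_le _ _).trans (add_le_add ((norm_add_le _ _).trans (add_le_add
      ((norm_add_le _ _).trans (add_le_add hl1 hl2)) hl3)) hl5)) hl6)).trans (le_of_eq ?_)
    rw [hΛC]; ring
  have hβs : ‖-((1 - (k : ℂ) / 2) + s - 1)‖ ≤ (‖(1 : ℂ) - (k : ℂ) / 2‖ + ‖z‖ + 2) := by
    rw [norm_neg]
    calc ‖(1 - (k : ℂ) / 2) + s - 1‖ ≤ ‖(1 - (k : ℂ) / 2) + s‖ + ‖(1 : ℂ)‖ := norm_sub_le _ _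
      _ ≤ ‖(1 : ℂ) - (k : ℂ) / 2‖ + ‖s‖ + ‖(1 : ℂ)‖ := by gcongr; exact norm_add_le _ _
      _ ≤ (‖(1 : ℂ) - (k : ℂ) / 2‖ + ‖z‖ + 2) := by rw [norm_one]; linarith only [hsn]
  have hΦ' : ‖(((P' : ℝ) : ℂ) * (-((1 - (k : ℂ) / 2) + s - 1) * Φ (1 + k / 2) (1 - k / 2 + 1) P s))‖ ≤ 256 * (‖(1 : ℂ) - (k : ℂ) / 2‖ + ‖z‖ + 2) * (CΦ' * Real.pi ^ K') * Sz ^ (K' + 3) * RX := by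
    rw [norm_mul, norm_mul, Complex.norm_real, Real.norm_eq_abs]
    calc |P'| * (‖-((1 - (k : ℂ) / 2) + s - 1)‖ * ‖Φ (1 + k / 2) (1 - k / 2 + 1) P s‖) ≤
        (256 * Sz ^ 2 * RX * P) * ((‖(1 : ℂ) - (k : ℂ) / 2‖ + ‖z‖ + 2) * ((CΦ' * Real.pi ^ K') * Sz ^ K')) := by gcongr
      _ ≤ (256 * Sz ^ 2 * RX * Sz) * ((‖(1 : ℂ) - (k : ℂ) / 2‖ + ‖z‖ + 2) * ((CΦ' * Real.pi ^ K') * Sz ^ K')) := by gcongr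
      _ = 256 * (‖(1 : ℂ) - (k : ℂ) / 2‖ + ‖z‖ + 2) * (CΦ' * Real.pi ^ K') * Sz ^ (K' + 3) * RX := by ring
  have hM : ‖(Φ (1 + k / 2) (1 - k / 2) P s * ((-(k : ℂ) * trc) + (((k : ℂ) - 2 * s - 2) * (((trc).re : ℝ) : ℂ)) + ((2 * Real.pi * I) * u') + (-(((P' : ℝ) : ℂ) / ((P : ℝ) : ℂ)) - (((P' * (Real.pi * t) : ℝ)) : ℂ)) + (((s + 1 + k / 2) + (s + 1 - k / 2) - 2) * (((P' / P + 2 * (trc).re : ℝ)) : ℂ))) + (((P' : ℝ) : ℂ) * (-((1 - (k : ℂ) / 2) + s - 1) * Φ (1 + k / 2) (1 - k / 2 + 1) P s)))‖ ≤ (CΦ * Real.pi ^ K) * Sz ^ K * (ΛC * Sz ^ 6 * RX) + 256 * (‖(1 : ℂ) - (k : ℂ) / 2‖ + ‖z‖ + 2) * (CΦ' * Real.pi ^ K') * Sz ^ (K' + 3) * RX :=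
    (norm_add_le _ _).trans (add_le_add (by rw [norm_mul]; exact mul_le_mul hF13 hΛ (norm_nonneg _) (by positivity)) hΦ')
  /- assemble -/
  refine (norm_mul_le _ _).trans ((mul_le_mul hG0 hM (norm_nonneg _) (by positivity)).trans ?_)
  have hT1 : (CΦ * Real.pi ^ K) * Sz ^ K * (ΛC * Sz ^ 6 * RX) ≤ (CΦ * Real.pi ^ K) * ΛC * RX * Sz ^ (K + K' + 9) := by
    calc (CΦ * Real.pi ^ K) * Sz ^ K * (ΛC * Sz ^ 6 * RX) = (CΦ * Real.pi ^ K) * ΛC * RX * Sz ^ (K + 6) := by ring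
      _ ≤ (CΦ * Real.pi ^ K) * ΛC * RX * Sz ^ (K + K' + 9) := mul_le_mul_of_nonneg_left (pow_le_pow_right₀ hSzone (by omega)) (by positivity)
  have hT2 : 256 * (‖(1 : ℂ) - (k : ℂ) / 2‖ + ‖z‖ + 2) * (CΦ' * Real.pi ^ K') * Sz ^ (K' + 3) * RX ≤ 256 * (‖(1 : ℂ) - (k : ℂ) / 2‖ + ‖z‖ + 2) * (CΦ' * Real.pi ^ K') * RX * Sz ^ (K + K' + 9) := by
    calc 256 * (‖(1 : ℂ) - (k : ℂ) / 2‖ + ‖z‖ + 2) * (CΦ' * Real.pi ^ K') * Sz ^ (K' + 3) * RX = 256 * (‖(1 : ℂ) - (k : ℂ) / 2‖ + ‖z‖ + 2) * (CΦ' * Real.pi ^ K') * RX * Sz ^ (K' + 3) := by ring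
      _ ≤ 256 * (‖(1 : ℂ) - (k : ℂ) / 2‖ + ‖z‖ + 2) * (CΦ' * Real.pi ^ K') * RX * Sz ^ (K + K' + 9) := mul_le_mul_of_nonneg_left (pow_le_pow_right₀ hSzone (by omega)) (by positivity)
  calc B₀ * Sz ^ (4 * n₁ + 4 * n₁ + 1 + 5 * n₂) * Real.exp (-(Real.pi * (P * t))) * ((CΦ * Real.pi ^ K) * Sz ^ K * (ΛC * Sz ^ 6 * RX) + 256 * (‖(1 : ℂ) - (k : ℂ) / 2‖ + ‖z‖ + 2) * (CΦ' * Real.pi ^ K') * Sz ^ (K' + 3) * RX)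
      ≤ B₀ * Sz ^ (4 * n₁ + 4 * n₁ + 1 + 5 * n₂) * Real.exp (-(Real.pi * (P * t))) * ((CΦ * Real.pi ^ K) * ΛC * RX * Sz ^ (K + K' + 9) + 256 * (‖(1 : ℂ) - (k : ℂ) / 2‖ + ‖z‖ + 2) * (CΦ' * Real.pi ^ K') * RX * Sz ^ (K + K' + 9)) :=
        mul_le_mul_of_nonneg_left (add_le_add hT1 hT2) (by positivity)
    _ = B₀ * ((CΦ * Real.pi ^ K) * ΛC + 256 * (‖(1 : ℂ) - (k : ℂ) / 2‖ + ‖z‖ + 2) * (CΦ' * Real.pi ^ K')) * RX * Sz ^ ((4 * n₁ + 4 * n₁ + 1 + 5 * n₂) + (K + K' + 9)) * Real.exp (-(Real.pi * (P * t))) := by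
        rw [pow_add]; ring

end Summit.HodgeConjecture.HodgeConjecture.Cruxes.HLiu418.K2LiuArchTwistedRayDerivBound

end
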